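import Mathlib
import HarnessLib
import Summits.ValiantsHypothesis.ValiantsHypothesis.Theses.MonotoneRestoration
import Literature.Computability.AlgebraicComplexity.ArithCircuit
import Literature.Computability.AlgebraicComplexity.ArithCircuitProofs
import Literature.Computability.AlgebraicComplexity.MonotoneStructure
import Literature.Computability.AlgebraicComplexity.PermanentIrreducible
import Literature.ModelTheory.FiniteModelTheory.CkEquiv
import Summits.ValiantsHypothesis.ValiantsHypothesis.Theorems.MonotoneRestorationMonotoneRestorationQPCosetCount
import Summits.ValiantsHypothesis.ValiantsHypothesis.Theorems.MonotoneRestorationMonotoneRestorationQPSymmetricLB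
import Summits.ValiantsHypothesis.ValiantsHypothesis.Theorems.MonotoneRestorationMonotoneRestorationQPSupportSymmetrisation
import Summits.ValiantsHypothesis.ValiantsHypothesis.Theorems.MonotoneRestorationMonotoneRestorationQPSparseRegime
import Summits.ValiantsHypothesis.ValiantsHypothesis.Theorems.MonotoneRestorationMonotoneRestorationQPBeta
import Literature.Computability.AlgebraicComplexity.SymmetricArithCircuit
import Literature.Computability.AlgebraicComplexity.DawarWilsenach2025Proofs
import Literature.GroupTheory.PermutationGroups.SmallIndexSubgroups
import Summits.ValiantsHypothesis.ValiantsHypothesis.Theorems.MonotoneRestorationQP.Negative.LoadBearing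
import Summits.ValiantsHypothesis.ValiantsHypothesis.Theorems.MonotoneRestorationMonotoneRestorationQPPermSupportCount

/-! TTRL-lite variant V20282 of stmt-ValiantsHypothesis-15886 -/

-- `Summit.ValiantsHypothesis.ValiantsHypothesis.…` is the tree's mandated single-conjunct layout
-- (Sub = Summit), so the duplicated namespace component is intended.
set_option linter.dupNamespace false

namespace Summit.ValiantsHypothesis.ValiantsHypothesis.Theorems

open Summit.ValiantsHypothesis.ValiantsHypothesis.Theses.MonotoneRestoration
open Literature.Computability.AlgebraicComplexity

/-- TTRL-lite variant V20282 of `stmt-ValiantsHypothesis-15886` (Vieta / generating-function form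
of the witness family): for `d ≤ n`, substituting the row sums `R i = ∑ j, X (i, j)` of an `n × n`
matrix of variables into the elementary symmetric polynomial `e_d` gives the coefficient of
`T ^ (n - d)` in `∏ i, (T + R i)`, computed in `Polynomial (MvPolynomial (Fin n × Fin n) ℝ≥0)`.
Proof: the left side is `Multiset.esymm` of the multiset of row sums
(`MvPolynomial.aeval_esymm_eq_multiset_esymm` through `bind₁ = aeval`), and the right side is the
same by Vieta's formula `Multiset.prod_X_add_C_coeff'` with `k = n - d`. -/
theorem stub_esymmRowSums_complexity_var20282 :
    ∀ n d : ℕ, d ≤ n → MvPolynomial.bind₁ (fun i : Fin n => ∑ j : Fin n, MvPolynomial.X (i, j))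
      (MvPolynomial.esymm (Fin n) NNReal d) =
      (∏ i : Fin n, (Polynomial.X + Polynomial.C (∑ j : Fin n,
        (MvPolynomial.X (i, j) : MvPolynomial (Fin n × Fin n) NNReal)))).coeff (n - d) := by
  intro n d hd
  have hcard : Multiset.card (Finset.univ : Finset (Fin n)).val = n := by
    rw [Finset.card_val, Finset.card_univ, Fintype.card_fin]
  rw [← MvPolynomial.aeval_eq_bind₁, MvPolynomial.aeval_esymm_eq_multiset_esymm,
    Finset.prod_eq_multiset_prod, Multiset.prod_X_add_C_coeff' _ _ (by omega), hcard,
    Nat.sub_sub_self hd]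

end Summit.ValiantsHypothesis.ValiantsHypothesis.Theorems
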